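import Summits.BirchSwinnertonDyer.BirchSwinnertonDyer.Theorems.GenusKolyvaginAtTwoGenusDeepSupplyAtTwoNegDiscNarrowKFourCellInvariantClasses
import Summits.BirchSwinnertonDyer.BirchSwinnertonDyer.Theorems.GenusKolyvaginAtTwoGenusPrimitiveSupplyAtTwoKolyvaginClassAtTwo
import Summits.BirchSwinnertonDyer.BirchSwinnertonDyer.Theorems.KolyvaginRankRigidityAtTwoKolyvaginCorankLowerBoundAtTwoSelmerAwayFromConductor
import Summits.BirchSwinnertonDyer.BirchSwinnertonDyer.Theorems.ClassRecordThreeEulerHalvesAtThreeKolyvaginClassTamagawaFreePlace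
import Summits.BirchSwinnertonDyer.BirchSwinnertonDyer.Theorems.ClassRecordThreeCornerAtThreeMilneTamagawaHolds
import Summits.BirchSwinnertonDyer.BirchSwinnertonDyer.Theorems.AdditiveKolyvaginRoadLevelKolyvaginSystemsAdditiveStubTamagawaOffP
import Literature.NumberTheory.EllipticCurves.McCallum1991.KolyvaginLocalLeavesHolds
import Summits.BirchSwinnertonDyer.BirchSwinnertonDyer.Theorems.Rank1ResidualJetCompatibleData
import Summits.BirchSwinnertonDyer.BirchSwinnertonDyer.Theses.GenusKolyvaginAtTwo
import HarnessLib

/-!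
# Route `GenusKolyvaginAtTwo`, crux 23491, K₄ cell: KOLYVAGIN'S LEVEL-1 CLASSES `c₁(ℓ) ∈ H¹(K, E[2])` — `Gal(K/ℚ)`-INVARIANT, SELMER AWAY
# FROM `ℓ` ON THE HABITAT (odd Tamagawa numbers), hence RESTRICTIONS OF UNIQUE `2`-SELMER CLASSES OF `E/ℚ` ONCE SELMER AT `λ ∣ ℓ`

LEAD seat `bsd-line-gk2-p1` g22, `--supports stmt-BirchSwinnertonDyer-23491 --as helper`; sequel of p765489 / p765896 / p766296 / p766389 (the «kernel
version» announced on STATUS 08:12Z/08:38Z).  THEOREMS ONLY.  **BSD is NOT proved by this file; nothing about Kolyvagin's conjecture at `2` is asserted;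
no item is closed.**  §§1–3 are UNCONDITIONAL; §4 is conditional on the two print facts of p766389 (Poitou–Tate for Selmer structures over `ℚ`,
the local Euler–Poincaré characteristic) and on ONE displayed local hypothesis `hlam` — the Selmer condition of `c₁(ℓ)` at the place(s) `λ ∣ ℓ`,
which is the route item Q2 `KolyvaginRelationAtTwo` (stmt-24880, McCallum Prop. 4.4 at `p = 2`) read at `(m, l, M, j) = (1, ℓ, 1, 0)` on the
`M₀ ≥ 1` cell (there `P(1) = y_K ∈ 2E(K)`, so `loc_λ c₁(1) = 0` and Q2 gives `c₁(ℓ) ∈ Sel_λ`; cdisprove's «all `c₁(ℓ)` are Selmer on `M₀ ≥ 1`»).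

* §1 `conjAct_kolyvaginClass_two_eq_self` — for `K` imaginary quadratic with odd `d_K ≠ −3` and the Heegner hypothesis, `ρ̄_{E,2}` onto, a
  Kolyvagin prime `ℓ` at `2` and ANY data `d₁` (conductor `1`) and `d` (conductor `ℓ`): **`σ₀ · c₁(ℓ) = c₁(ℓ)`** in `H¹(K, E[2])`
  (Gross Prop. 5.4 (2): `σ₀ c = ±c`, and `−c = c` on `2`-torsion).  UNCONDITIONAL (McCallum 1991 leaves, `…_zhang` sign law with Gross 5.3
  discharged and admissibility at `2` from `GenusKoly.isAdmissible_pointsSubgroup_two`).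
* §2 `kolyvaginClass_two_mem_selmerLocalKer_of_not_mem` — **Gross Prop. 6.2 (1) at ALL places `v ∤ n` on the habitat**: `K` imaginary
  quadratic Heegner for `N_E`, `∏ c_v(E)` ODD ⟹ at every finite `v ∤ n` (bad places included) `c_M(n) ∈ Sel_v` (the bad prime splits, `c_v(E_K) = c_ℓ(E)`
  is odd, Milne *ADT* I.3.8 kills unramified classes by `c_v`, Bézout with `2^M`).  UNCONDITIONAL — no [GZ86 III (3.1)], no receptacle.
* §3 `kolyvaginClass_two_mem_selmerGroup_of_dvd` — so `c_M(n) ∈ Sel^{(2^M)}(E/K)` as soon as it is Selmer at the places dividing `n`.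
* §4 `existsUnique_resTorsion_eq_kolyvaginClass_two_of_cell` — ON THE K₄ CELL (Δ<0, `#Sel₂(E)=4`, prime frame `d_K = −ℓ₀`, `2` split, twin
  `#Sel₂(Wd) = 2`, `E(K)[2] = 0`): a level-1 class `c₁(ℓ)` that is Selmer at `λ ∣ ℓ` is `res_K s` for a UNIQUE `s ∈ H¹(ℚ, E[2])`, and
  `s ∈ Sel₂(E/ℚ)`; and `c₁(ℓ) ≠ 0 ⟺ P(ℓ) ∉ 2E(K[ℓ])` (McCallum Cor. 4.5 at `2`).  READING for K₄′: the registered positive-depth kernel asks, at a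
  single deep prime, for a `c₁(ℓ)` REALISING one of the three non-zero classes of `Sel₂(E/ℚ) ≅ Ш(E/ℚ)[2] ≅ (ℤ/2)²`.

References: [GrossLMS1991] §§4–6; [McCallumLMS1991] §4; [MilneADT2006] I.3.8; [SilvermanAEC2009] VII.6.1; [Castella2018] §5; [Kramer1981] Thm. 1.
-/

set_option linter.dupNamespace false -- tree convention: `Summit.BirchSwinnertonDyer.BirchSwinnertonDyer.Theorems` (summit = sub-problem)
set_option autoImplicit false

noncomputable section

open scoped Classical

namespace Summit.BirchSwinnertonDyer.BirchSwinnertonDyer.Theorems.GenusSupplyNarrow.KFourCell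

open WeierstrassCurve NumberField IsDedekindDomain Field Function
open Literature.NumberTheory.EllipticCurves Literature.NumberTheory.GaloisRepresentations
open Literature.NumberTheory.GaloisCohomology
open Literature.NumberTheory.EllipticCurves.ModularForms Literature.NumberTheory.EllipticCurves.KolyvaginCocycle
open Summit.BirchSwinnertonDyer.Rank1Residual.X11b

section Classes

-- `K : Type`: the tree's ring-class class field theory is universe `0`.
variable {W : WeierstrassCurve ℚ} [W.IsElliptic] [W.IsGloballyMinimal] [NeZero (W.conductorNorm ℤ)]
  {K : Type} [Field K] [NumberField K]
  {Dt : ModularParametrizationData W (W.conductorNorm ℤ)} {β : ℤ} {ι : K →+* ℂ}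

/-! ## §1 `Gal(K/ℚ)` fixes the level-1 classes `c₁(ℓ)` -/

/-- **`σ₀ · c₁(ℓ) = c₁(ℓ)` in `H¹(K, E[2])`** for the non-trivial `σ₀ ∈ Aut(K/ℚ)`, any conductor-`1` datum `d₁` and conductor-`ℓ` datum `d` on a
frame `(Dt, β, ι)` of the globally minimal `W/ℚ` with `ρ̄_{E,2}` onto, `K` imaginary quadratic with odd `d_K ≠ −3` and the Heegner hypothesis,
`ℓ` a Kolyvagin prime at `2`.  Gross's Prop. 5.4 (2) (McCallum §5; the tree's sign law `conjAct_kolyvaginClass_eq_sign_smul_zhang` with Prop. 5.3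
discharged by `exists_mem_ringClassGal_isOfFinAddOrder_conj_sub_smul` and admissibility AT `2` by `GenusKoly.isAdmissible_pointsSubgroup_two`) gives
`σ₀ c₁(ℓ) = ±c₁(ℓ)`, and `2 · c₁(ℓ) = 0` (McCallum Lemma 4.1).  UNCONDITIONAL. [cite: GrossLMS1991, §5 Prop. 5.3, Prop. 5.4 (2)]
[cite: McCallumLMS1991, §4 Lemma 4.1, (4.2), §5] -/
theorem conjAct_kolyvaginClass_two_eq_self (hK : IsImaginaryQuadratic K) (hodd : Odd (NumberField.discr K))
    (h3 : NumberField.discr K ≠ -3) (hH : SatisfiesHeegnerHypothesis (W.conductorNorm ℤ) K)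
    (hsurj : W.HasSurjectiveModNGaloisRep ((2 : ℤ) ^ 1)) {ℓ : ℕ} (hKoly : Zhang2014.IsKolyvaginPrime (W.conductorNorm ℤ) W K 2 ℓ)
    (d₁ : KolyvaginHeegnerData Dt β ι 1) (d : KolyvaginHeegnerData Dt β ι ℓ) {σ₀ : K ≃ₐ[ℚ] K} (hσ₀ : σ₀ ≠ 1) :
    conjAct W σ₀ ((2 ^ 1 : ℕ) : ℤ) (d.kolyvaginClass Nat.prime_two 1) = d.kolyvaginClass Nat.prime_two 1 := by
  have hℓ : ℓ.Prime := hKoly.1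
  -- the two data as a family over the divisors `{1, ℓ}` of `ℓ`
  let fam : (m : ℕ) → m ∣ ℓ → KolyvaginHeegnerData Dt β ι m := fun m hm ↦
    if h : m = ℓ then h ▸ d else ((Nat.dvd_prime hℓ).mp hm).resolve_right h ▸ d₁
  have hfam : fam ℓ dvd_rfl = d := by simp [fam]
  have hkol : ∀ q ∈ ℓ.primeFactors, Zhang2014.IsKolyvaginPrime (W.conductorNorm ℤ) W K 2 q ∧ 1 ≤ Zhang2014.kolyvaginIndex W 2 q := by
    intro q hq
    rw [hℓ.primeFactors, Finset.mem_singleton] at hq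
    subst hq
    exact ⟨hKoly, hKoly.2.2.2.2.2⟩
  have hND : IsCoprime ((W.conductorNorm ℤ : ℕ) : ℤ) (NumberField.discr K) := GenusKoly.heegner_isCoprime_conductorNorm_discr hK hH
  have hD : NumberField.discr K < -4 := GenusKoly.discr_lt_neg_four_of_odd hK hodd h3
  have h53 : ∀ (m : ℕ) (hm : m ∣ ℓ) (τm : ringClassField K ι m ≃ₐ[ℚ] ringClassField K ι m),
      (∀ x : ringClassField K ι m, ((τm x : ringClassField K ι m) : ℂ) = starRingEnd ℂ x) →
      ∃ σ' ∈ ringClassGal ι m, IsOfFinAddOrder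
        (pointGalHom W (ringClassField K ι m) τm (fam m hm).y -
          (-W.rootNumber) • pointGalHom W (ringClassField K ι m) σ' (fam m hm).y) := by
    intro m hm τm hτm
    obtain ⟨hm0, hmN⟩ := McCallum1991.ne_zero_and_coprime_of_isKolyvaginPrime (K := K) (hℓ.squarefree.squarefree_of_dvd hm)
      (fun q hq ↦ (hkol q (Nat.primeFactors_mono hm hℓ.ne_zero hq)).1)
    exact McCallum1991.exists_mem_ringClassGal_isOfFinAddOrder_conj_sub_smul W hK hH Dt ι hm0 hmN (fam m hm) τm hτm
  have hA : ∀ (m : ℕ) (hm : m ∣ ℓ), IsAdmissible (absoluteGaloisGroup K) (fam m hm).pointsSubgroup ((2 ^ 1 : ℕ) : ℤ) :=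
    fun m hm ↦ GenusKoly.isAdmissible_pointsSubgroup_two hK hodd hH hsurj (ne_zero_of_dvd_ne_zero hℓ.ne_zero hm) (fam m hm) 1
  have h := McCallum1991.conjAct_kolyvaginClass_eq_sign_smul_zhang (c := σ₀) hK ι Nat.prime_two le_rfl Dt hND hD hℓ.squarefree hkol
    fam hσ₀ (-W.rootNumber) h53 hA ℓ dvd_rfl
  rw [hfam] at h
  rw [h]
  -- the sign is `±1` and `−c = c` on `2`-torsion classes
  have h2c : ((2 ^ 1 : ℕ) : ℤ) • d.kolyvaginClass Nat.prime_two 1 = 0 :=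
    KolyvaginRankRigidity.pow_natCast_zsmul_kolyvaginClass_eq_zero d Nat.prime_two 1
  have hneg : -d.kolyvaginClass Nat.prime_two 1 = d.kolyvaginClass Nat.prime_two 1 := by
    have h2c' : (2 : ℤ) • d.kolyvaginClass Nat.prime_two 1 = 0 := by
      rw [show (2 : ℤ) = ((2 ^ 1 : ℕ) : ℤ) by norm_num]
      exact h2c
    rw [two_zsmul] at h2c'
    exact neg_eq_of_add_eq_zero_left h2c'
  rcases W.rootNumber_eq_one_or with h1 | h1 <;> rcases neg_one_pow_eq_or ℤ ℓ.primeFactors.card with hs | hs <;>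
    simp [h1, hs, hneg]

/-! ## §2 Gross's Prop. 6.2 (1) at the bad places of the habitat: odd Tamagawa numbers -/

omit [W.IsGloballyMinimal] in
/-- **`c_M(n) ∈ Sel_v` at EVERY finite place `v ∤ n` (good or bad), on the habitat `∏ c(E) odd`** (any `M`, any concrete datum `d` of conductor
`n ≠ 0`; at a good place `c_v = 1` and this is krr2's `kolyvaginClass_mem_selmerLocalKer_of_hasGoodReductionAt`).  `K` imaginary quadratic with the Heegner hypothesis for `N_E`: the rational prime `q` below a bad `v` divides `N_E`, so it SPLITS in `K`
and `c_v(E_K) = c_q(E)` (degree-one transport, `AdditiveKoly.not_dvd_localTamagawaNumber_baseChange_of_split`), a factor of the odd `∏ c(E)`;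
inertia at `v ∤ n` fixes `E(K[n])` (`KolyvaginRankRigidity.smul_toGeomPoints_eq_self_of_mem_localInertia`); unramified classes of `H¹(K_v, E)` are
killed by `c_v` (Milne *ADT* I.3.8, the tree's DISCHARGED `Milne2006_localTamagawaNumber_smul_unramifiedClass_eq_zero_holds`); `gcd(2^M, c_v) = 1`
⟹ `c_M(n) ∈ Sel_v` (`TamagawaFreePlace.…_of_inertia_of_localTamagawaNumber_smul`).  Junk branch: the class is `0`.  UNCONDITIONAL.
[cite: GrossLMS1991, §6 Prop. 6.2 (1), pp. 244–245] [cite: MilneADT2006, Ch. I Prop. 3.8] [cite: SilvermanAEC2009, Thm. VII.6.1] [cite: Castella2018, §5] -/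
theorem kolyvaginClass_two_mem_selmerLocalKer_of_not_mem (hK : IsImaginaryQuadratic K)
    (hH : SatisfiesHeegnerHypothesis (W.conductorNorm ℤ) K) (hT : Odd W.tamagawaProduct)
    {n : ℕ} (hn : n ≠ 0) (d : KolyvaginHeegnerData Dt β ι n) (M : ℕ) (v : HeightOneSpectrum (𝓞 K))
    (hv : ((n : ℕ) : 𝓞 K) ∉ v.asIdeal) :
    d.kolyvaginClass Nat.prime_two M ∈ selmerLocalKer (W.baseChange K) (v.adicCompletion K) ((2 ^ M : ℕ) : ℤ) := by
  haveI : (W.baseChange K).IsElliptic := by rw [baseChange]; infer_instance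
  by_cases h : IsAdmissible (absoluteGaloisGroup K) d.pointsSubgroup ((2 ^ M : ℕ) : ℤ) ∧
      d.toGeomPoints d.derivedPoint ∈ invPoints (absoluteGaloisGroup K) d.pointsSubgroup ((2 ^ M : ℕ) : ℤ)
  · rw [d.kolyvaginClass_of_admissible Nat.prime_two M h.1 h.2]
    obtain ⟨𝔐, h𝔐⟩ := v.localPrimesAbove_nonempty
    haveI : Fact (Nat.Prime 2) := ⟨Nat.prime_two⟩
    -- `c_v(E_K)` is odd: the bad prime splits (Heegner hypothesis) and `∏ c(E)` is odd
    have h2T : ¬ 2 ∣ W.tamagawaProduct := fun h2 ↦ (Nat.not_even_iff_odd.mpr hT) (even_iff_two_dvd.mpr h2)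
    have h2c : ¬ 2 ∣ ((W.baseChange K).baseChange (v.adicCompletion K)).localTamagawaNumber (v.adicCompletionIntegers K) :=
      AdditiveKoly.not_dvd_localTamagawaNumber_baseChange_of_split 2 W hK.1 h2T v fun hb ↦
        hH _ (Rat.HeightOneSpectrum.prime_natGenerator _) (AdditiveKoly.natGenerator_dvd_conductorNorm_of_not_hasGoodReductionAt W v hb)
    exact TamagawaFreePlace.kolyvaginClass_mem_selmerLocalKer_of_inertia_of_localTamagawaNumber_smul (W.baseChange K) h.1 h.2 v
      (fun t ht ↦ KolyvaginRankRigidity.smul_toGeomPoints_eq_self_of_mem_localInertia d hK hn hv h𝔐 ht d.derivedPoint)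
      (TamagawaFreePlace.isCoprime_pow_natCast_of_not_dvd Nat.prime_two M h2c)
      (MilneTamagawa.Milne2006_localTamagawaNumber_smul_unramifiedClass_eq_zero_holds (W.baseChange K) v h𝔐)
  · rw [KolyvaginHeegnerData.kolyvaginClass, dif_neg h]
    exact AddSubgroup.zero_mem _

/-! ## §3 `c_M(n)` is a Selmer class once it is Selmer at the places dividing `n` -/

omit [W.IsGloballyMinimal] in
/-- **`c_M(n) ∈ Sel^{(2^M)}(E/K)` on the habitat, modulo the places `v ∣ n`**: every finite `v ∤ n` by §2, archimedean places impose nothing (`K` totally complex); the condition at `v ∣ n` is the displayed `hdvd` (McCallum Prop. 4.4 ∕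
Kolyvagin's relation — the route item Q2 at `2`).  [cite: GrossLMS1991, §6 Prop. 6.2] [cite: McCallumLMS1991, §4 Lemma 4.3, Prop. 4.4] -/
theorem kolyvaginClass_two_mem_selmerGroup_of_dvd (hK : IsImaginaryQuadratic K) (hH : SatisfiesHeegnerHypothesis (W.conductorNorm ℤ) K)
    (hT : Odd W.tamagawaProduct) {n : ℕ} (hn : n ≠ 0) (d : KolyvaginHeegnerData Dt β ι n) (M : ℕ)
    (hdvd : ∀ v : HeightOneSpectrum (𝓞 K), ((n : ℕ) : 𝓞 K) ∈ v.asIdeal →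
      d.kolyvaginClass Nat.prime_two M ∈ selmerLocalKer (W.baseChange K) (v.adicCompletion K) ((2 ^ M : ℕ) : ℤ)) :
    d.kolyvaginClass Nat.prime_two M ∈ selmerGroup (W.baseChange K) ((2 ^ M : ℕ) : ℤ) :=
  KolyvaginRankRigidity.kolyvaginClass_mem_selmerGroup_of_bad_of_dvd d hK hn Nat.prime_two M
    (fun v hv _ ↦ kolyvaginClass_two_mem_selmerLocalKer_of_not_mem hK hH hT hn d M v hv) hdvd

end Classes

/-! ## §4 On the K₄ cell: `c₁(ℓ) = res_K s` for a unique `s ∈ Sel₂(E/ℚ)`, and `c₁(ℓ) ≠ 0 ⟺ P(ℓ) ∉ 2E(K[ℓ])` -/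

section Cell

variable (W : WeierstrassCurve ℚ) [W.IsElliptic] [W.IsGloballyMinimal] (K : Type) [Field K] [NumberField K]

/-- p766389 `existsUnique_mem_selmerGroup_resTorsion_eq_of_cell` at an exponent `e` merely EQUAL to `2` (bookkeeping: Kolyvagin's classes live at
the syntactic exponent `2 ^ 1`). [cite: Kramer1981, Thm. 1] [cite: GrossLMS1991, §4 (4.4)] -/
theorem existsUnique_mem_selmerGroup_resTorsion_eq_of_cell_of_eq
    (hPT : poitouTate_selmerStructure_duality_real ℚ)
    (hEP : ∀ v : HeightOneSpectrum (𝓞 ℚ), localEulerPoincareCharacteristic (v.adicCompletion ℚ))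
    (hΔ : W.Δ < 0) (h4 : Nat.card (W.selmerGroup 2) = 4) (hK : IsImaginaryQuadratic K) (hodd : Odd (discr K))
    (hH : SatisfiesHeegnerHypothesis (W.conductorNorm ℤ) K) (h2K : ((Ideal.span {(2 : ℤ)}).primesOver (𝓞 K)).ncard = 2)
    {ℓ₀ : ℕ} [Fact ℓ₀.Prime] (hd : discr K = -(ℓ₀ : ℤ))
    (Wd : WeierstrassCurve ℚ) [Wd.IsElliptic] (hWd : ∃ C : VariableChange ℚ, C • W.quadraticTwist (discr K : ℚ) = Wd)
    (hSel : Nat.card (Wd.selmerGroup 2) = 2)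
    (hL : ∀ P : (W.baseChange K).toAffine.Point, ((2 : ℕ) : ℤ) • P = 0 → P = 0)
    {σ₀ : K ≃ₐ[ℚ] K} (hσ₀ : σ₀ ≠ 1) {e : ℤ} (he : e = ((2 : ℕ) : ℤ))
    {m : galH1Torsion (W.baseChange K) e} (hm : m ∈ selmerGroup (W.baseChange K) e) (hσm : conjAct W σ₀ e m = m) :
    ∃! s : galH1Torsion W e, resTorsion W K e s = m ∧ s ∈ W.selmerGroup e := by
  subst he
  exact existsUnique_mem_selmerGroup_resTorsion_eq_of_cell W K hPT hEP hΔ h4 hK hodd hH h2K hd Wd hWd hSel hL hσ₀ hm hσm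

/-- **THE LEVEL-1 DEEP CLASSES ON THE K₄ CELL DESCEND TO `Sel₂(E/ℚ)`.**  On the K₄ cell of crux 23491 on the prime frame (`W/ℚ` globally minimal,
`Δ < 0`, `ρ̄_{E,2}` onto, `∏ c(E)` odd, `#Sel₂(E) = 4`; `K` imaginary quadratic, `d_K = −ℓ₀` odd prime `≠ 3`, Heegner for `N_E`, `2` split;
a minimal twin `Wd ≅ E^{(d_K)}` with `#Sel₂(Wd) = 2`; `E(K)[2] = 0`; `σ₀ ≠ 1` in `Aut(K/ℚ)`), for a Kolyvagin prime `ℓ` at `2` and data `d₁`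
(conductor `1`), `d` (conductor `ℓ`) whose class `c₁(ℓ)` satisfies the Selmer condition at the place(s) of `K` above `ℓ` (`hlam` — Q2 at `2` on the
`M₀ ≥ 1` cell), MODULO Poitou–Tate ∕ Euler–Poincaré: **there is a unique `s ∈ H¹(ℚ, E[2])` with `res_K s = c₁(ℓ)`, it lies in `Sel₂(E/ℚ)`, and
`c₁(ℓ) ≠ 0 ⟺ P(ℓ) ∉ 2E(K[ℓ])`.**  (§3 + §1 + p766389 + McCallum Cor. 4.5 at `2`.)  So the positive-depth kernel K₄′ at a single deep prime asks
for a `P(ℓ) ∉ 2E(K[ℓ])`, i.e. for a `c₁(ℓ)` realising a NON-ZERO class of `Sel₂(E/ℚ) ≅ Ш(E/ℚ)[2] ≅ (ℤ/2)²`.  CONDITIONAL (hPT, hEP, hlam).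
BSD is NOT proved by this. [cite: GrossLMS1991, §4 (4.4), Prop. 4.7 (1), §6 Prop. 6.2] [cite: McCallumLMS1991, Prop. 4.4, Cor. 4.5] [cite: Kramer1981, Thm. 1] -/
theorem existsUnique_resTorsion_eq_kolyvaginClass_two_of_cell [NeZero (W.conductorNorm ℤ)]
    (hPT : poitouTate_selmerStructure_duality_real ℚ)
    (hEP : ∀ v : HeightOneSpectrum (𝓞 ℚ), localEulerPoincareCharacteristic (v.adicCompletion ℚ))
    (hΔ : W.Δ < 0) (hsurj : W.HasSurjectiveModNGaloisRep ((2 : ℤ) ^ 1)) (hT : Odd W.tamagawaProduct)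
    (h4 : Nat.card (W.selmerGroup 2) = 4) (hK : IsImaginaryQuadratic K) (hodd : Odd (discr K)) (h3 : discr K ≠ -3)
    (hH : SatisfiesHeegnerHypothesis (W.conductorNorm ℤ) K) (h2K : ((Ideal.span {(2 : ℤ)}).primesOver (𝓞 K)).ncard = 2)
    {ℓ₀ : ℕ} [Fact ℓ₀.Prime] (hd : discr K = -(ℓ₀ : ℤ))
    (Wd : WeierstrassCurve ℚ) [Wd.IsElliptic] (hWd : ∃ C : VariableChange ℚ, C • W.quadraticTwist (discr K : ℚ) = Wd)
    (hSel : Nat.card (Wd.selmerGroup 2) = 2)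
    (hL : ∀ P : (W.baseChange K).toAffine.Point, ((2 : ℕ) : ℤ) • P = 0 → P = 0)
    {σ₀ : K ≃ₐ[ℚ] K} (hσ₀ : σ₀ ≠ 1)
    {Dt : ModularParametrizationData W (W.conductorNorm ℤ)} {β : ℤ} {ι : K →+* ℂ}
    {ℓ : ℕ} (hKoly : Zhang2014.IsKolyvaginPrime (W.conductorNorm ℤ) W K 2 ℓ)
    (d₁ : KolyvaginHeegnerData Dt β ι 1) (d : KolyvaginHeegnerData Dt β ι ℓ)
    (hlam : ∀ v : HeightOneSpectrum (𝓞 K), ((ℓ : ℕ) : 𝓞 K) ∈ v.asIdeal →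
      d.kolyvaginClass Nat.prime_two 1 ∈ selmerLocalKer (W.baseChange K) (v.adicCompletion K) ((2 ^ 1 : ℕ) : ℤ)) :
    (∃! s : galH1Torsion W ((2 ^ 1 : ℕ) : ℤ),
        resTorsion W K ((2 ^ 1 : ℕ) : ℤ) s = d.kolyvaginClass Nat.prime_two 1 ∧ s ∈ W.selmerGroup ((2 ^ 1 : ℕ) : ℤ)) ∧
      (d.kolyvaginClass Nat.prime_two 1 ≠ 0 ↔
        ¬ ∃ Q : (W.baseChange (ringClassField K ι ℓ)).toAffine.Point, (2 : ℤ) • Q = d.derivedPoint) := by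
  have hSelK : d.kolyvaginClass Nat.prime_two 1 ∈ selmerGroup (W.baseChange K) ((2 ^ 1 : ℕ) : ℤ) :=
    kolyvaginClass_two_mem_selmerGroup_of_dvd hK hH hT hKoly.1.ne_zero d 1 hlam
  have hfix := conjAct_kolyvaginClass_two_eq_self hK hodd h3 hH hsurj hKoly d₁ d hσ₀
  exact ⟨existsUnique_mem_selmerGroup_resTorsion_eq_of_cell_of_eq W K hPT hEP hΔ h4 hK hodd hH h2K hd Wd hWd hSel hL hσ₀
      (by norm_num) hSelK hfix,
    GenusKoly.kolyvaginClass_two_ne_zero_iff_not_two_dvd_prime hK hodd h3 hH hsurj hKoly d₁ d⟩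

end Cell

/-! ## §5 Square-free levels: the same for a FAMILY of data at the divisors of `n` -/

section Family

variable {W : WeierstrassCurve ℚ} [W.IsElliptic] [W.IsGloballyMinimal] [NeZero (W.conductorNorm ℤ)]
  {K : Type} [Field K] [NumberField K]
  {Dt : ModularParametrizationData W (W.conductorNorm ℤ)} {β : ℤ} {ι : K →+* ℂ}

/-- **`σ₀ · c₁(n) = c₁(n)`** for the top class of a family of data at the divisors of a square-free product `n` of Kolyvagin primes at `2`
(§1 for families: the sign law needs data at every divisor).  UNCONDITIONAL. [cite: GrossLMS1991, §5 Prop. 5.3, Prop. 5.4 (2)] [cite: McCallumLMS1991, §4 Lemma 4.1, §5] -/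
theorem conjAct_kolyvaginClass_two_eq_self_of_family (hK : IsImaginaryQuadratic K) (hodd : Odd (NumberField.discr K))
    (h3 : NumberField.discr K ≠ -3) (hH : SatisfiesHeegnerHypothesis (W.conductorNorm ℤ) K)
    (hsurj : W.HasSurjectiveModNGaloisRep ((2 : ℤ) ^ 1)) {n : ℕ} (hn : Squarefree n)
    (hkol : ∀ q ∈ n.primeFactors, Zhang2014.IsKolyvaginPrime (W.conductorNorm ℤ) W K 2 q)
    (fam : (m : ℕ) → m ∣ n → KolyvaginHeegnerData Dt β ι m) {σ₀ : K ≃ₐ[ℚ] K} (hσ₀ : σ₀ ≠ 1) :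
    conjAct W σ₀ ((2 ^ 1 : ℕ) : ℤ) ((fam n dvd_rfl).kolyvaginClass Nat.prime_two 1) = (fam n dvd_rfl).kolyvaginClass Nat.prime_two 1 := by
  have hkol' : ∀ q ∈ n.primeFactors, Zhang2014.IsKolyvaginPrime (W.conductorNorm ℤ) W K 2 q ∧ 1 ≤ Zhang2014.kolyvaginIndex W 2 q :=
    fun q hq ↦ ⟨hkol q hq, (hkol q hq).2.2.2.2.2⟩
  have hND : IsCoprime ((W.conductorNorm ℤ : ℕ) : ℤ) (NumberField.discr K) := GenusKoly.heegner_isCoprime_conductorNorm_discr hK hH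
  have hD : NumberField.discr K < -4 := GenusKoly.discr_lt_neg_four_of_odd hK hodd h3
  have h53 : ∀ (m : ℕ) (hm : m ∣ n) (τm : ringClassField K ι m ≃ₐ[ℚ] ringClassField K ι m),
      (∀ x : ringClassField K ι m, ((τm x : ringClassField K ι m) : ℂ) = starRingEnd ℂ x) →
      ∃ σ' ∈ ringClassGal ι m, IsOfFinAddOrder
        (pointGalHom W (ringClassField K ι m) τm (fam m hm).y -
          (-W.rootNumber) • pointGalHom W (ringClassField K ι m) σ' (fam m hm).y) := by
    intro m hm τm hτm
    obtain ⟨hm0, hmN⟩ := McCallum1991.ne_zero_and_coprime_of_isKolyvaginPrime (K := K) (hn.squarefree_of_dvd hm)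
      (fun q hq ↦ hkol q (Nat.primeFactors_mono hm hn.ne_zero hq))
    exact McCallum1991.exists_mem_ringClassGal_isOfFinAddOrder_conj_sub_smul W hK hH Dt ι hm0 hmN (fam m hm) τm hτm
  have hA : ∀ (m : ℕ) (hm : m ∣ n), IsAdmissible (absoluteGaloisGroup K) (fam m hm).pointsSubgroup ((2 ^ 1 : ℕ) : ℤ) :=
    fun m hm ↦ GenusKoly.isAdmissible_pointsSubgroup_two hK hodd hH hsurj (ne_zero_of_dvd_ne_zero hn.ne_zero hm) (fam m hm) 1
  rw [McCallum1991.conjAct_kolyvaginClass_eq_sign_smul_zhang (c := σ₀) hK ι Nat.prime_two le_rfl Dt hND hD hn hkol' fam hσ₀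
    (-W.rootNumber) h53 hA n dvd_rfl]
  have h2c : ((2 ^ 1 : ℕ) : ℤ) • (fam n dvd_rfl).kolyvaginClass Nat.prime_two 1 = 0 :=
    KolyvaginRankRigidity.pow_natCast_zsmul_kolyvaginClass_eq_zero (fam n dvd_rfl) Nat.prime_two 1
  have hneg : -(fam n dvd_rfl).kolyvaginClass Nat.prime_two 1 = (fam n dvd_rfl).kolyvaginClass Nat.prime_two 1 := by
    have h2c' : (2 : ℤ) • (fam n dvd_rfl).kolyvaginClass Nat.prime_two 1 = 0 := by
      rw [show (2 : ℤ) = ((2 ^ 1 : ℕ) : ℤ) by norm_num]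
      exact h2c
    rw [two_zsmul] at h2c'
    exact neg_eq_of_add_eq_zero_left h2c'
  rcases W.rootNumber_eq_one_or with h1 | h1 <;> rcases neg_one_pow_eq_or ℤ n.primeFactors.card with hs | hs <;>
    simp [h1, hs, hneg]

/-- **§4 at a square-free level `n` with data at every divisor** (the K₄′ witness shape `∃ n d, Squarefree n ∧ …`): on the K₄ cell, the top class
`c₁(n)` of a family, Selmer at the places dividing `n`, is `res_K s` for a unique `s`, `s ∈ Sel₂(E/ℚ)`, and `c₁(n) ≠ 0 ⟺ P(n) ∉ 2E(K[n])`.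
CONDITIONAL (hPT, hEP, hlam). [cite: GrossLMS1991, §4 (4.4), Prop. 4.7 (1)] [cite: McCallumLMS1991, Prop. 4.4, Cor. 4.5] [cite: Kramer1981, Thm. 1] -/
theorem existsUnique_resTorsion_eq_kolyvaginClass_two_of_cell_of_family
    (hPT : poitouTate_selmerStructure_duality_real ℚ)
    (hEP : ∀ v : HeightOneSpectrum (𝓞 ℚ), localEulerPoincareCharacteristic (v.adicCompletion ℚ))
    (hΔ : W.Δ < 0) (hsurj : W.HasSurjectiveModNGaloisRep ((2 : ℤ) ^ 1)) (hT : Odd W.tamagawaProduct)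
    (h4 : Nat.card (W.selmerGroup 2) = 4) (hK : IsImaginaryQuadratic K) (hodd : Odd (discr K)) (h3 : discr K ≠ -3)
    (hH : SatisfiesHeegnerHypothesis (W.conductorNorm ℤ) K) (h2K : ((Ideal.span {(2 : ℤ)}).primesOver (𝓞 K)).ncard = 2)
    {ℓ₀ : ℕ} [Fact ℓ₀.Prime] (hd : discr K = -(ℓ₀ : ℤ))
    (Wd : WeierstrassCurve ℚ) [Wd.IsElliptic] (hWd : ∃ C : VariableChange ℚ, C • W.quadraticTwist (discr K : ℚ) = Wd)
    (hSel : Nat.card (Wd.selmerGroup 2) = 2)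
    (hL : ∀ P : (W.baseChange K).toAffine.Point, ((2 : ℕ) : ℤ) • P = 0 → P = 0)
    {σ₀ : K ≃ₐ[ℚ] K} (hσ₀ : σ₀ ≠ 1) {n : ℕ} (hn : Squarefree n)
    (hkol : ∀ q ∈ n.primeFactors, Zhang2014.IsKolyvaginPrime (W.conductorNorm ℤ) W K 2 q)
    (fam : (m : ℕ) → m ∣ n → KolyvaginHeegnerData Dt β ι m)
    (hlam : ∀ v : HeightOneSpectrum (𝓞 K), ((n : ℕ) : 𝓞 K) ∈ v.asIdeal →
      (fam n dvd_rfl).kolyvaginClass Nat.prime_two 1 ∈ selmerLocalKer (W.baseChange K) (v.adicCompletion K) ((2 ^ 1 : ℕ) : ℤ)) :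
    (∃! s : galH1Torsion W ((2 ^ 1 : ℕ) : ℤ),
        resTorsion W K ((2 ^ 1 : ℕ) : ℤ) s = (fam n dvd_rfl).kolyvaginClass Nat.prime_two 1 ∧ s ∈ W.selmerGroup ((2 ^ 1 : ℕ) : ℤ)) ∧
      ((fam n dvd_rfl).kolyvaginClass Nat.prime_two 1 ≠ 0 ↔
        ¬ ∃ Q : (W.baseChange (ringClassField K ι n)).toAffine.Point, (2 : ℤ) • Q = (fam n dvd_rfl).derivedPoint) := by
  have hSelK : (fam n dvd_rfl).kolyvaginClass Nat.prime_two 1 ∈ selmerGroup (W.baseChange K) ((2 ^ 1 : ℕ) : ℤ) :=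
    kolyvaginClass_two_mem_selmerGroup_of_dvd hK hH hT hn.ne_zero (fam n dvd_rfl) 1 hlam
  have hfix := conjAct_kolyvaginClass_two_eq_self_of_family hK hodd h3 hH hsurj hn hkol fam hσ₀
  refine ⟨existsUnique_mem_selmerGroup_resTorsion_eq_of_cell_of_eq W K hPT hEP hΔ h4 hK hodd hH h2K hd Wd hWd hSel hL hσ₀
      (by norm_num) hSelK hfix, ?_⟩
  rw [GenusKoly.kolyvaginClass_two_ne_zero_iff_not_two_dvd hK hodd h3 hH hsurj hn hkol fam]

end Family

/-! ## §6 The local hypothesis `hlam` at a single prime FROM THE ROUTE ITEM Q2 on the `M₀ ≥ 1` cell -/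

section Relation

open Summit.BirchSwinnertonDyer.BirchSwinnertonDyer.Theses.GenusKolyvaginAtTwo (KolyvaginRelationAtTwo)
open Summit.BirchSwinnertonDyer.Rank1Residual

variable {W : WeierstrassCurve ℚ} [W.IsElliptic] [W.IsGloballyMinimal] [NeZero (W.conductorNorm ℤ)]
  {K : Type} [Field K] [NumberField K]

/-- **`c₁(1) = 0` on the `M₀ ≥ 1` cell**: if `2^{M₀} ∣ P(1)` in `E(K[1])` with `M₀ ≥ 1` then the conductor-`1` class vanishes (McCallum Cor. 4.5 at
`2`, level `1`: `c₁(1) ≠ 0 ⟺ P(1) ∉ 2E(K[1])`).  UNCONDITIONAL. [cite: McCallumLMS1991, Cor. 4.5] [cite: GrossLMS1991, Prop. 4.7 (1)] -/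
theorem kolyvaginClass_two_one_eq_zero_of_depth_pos (hK : IsImaginaryQuadratic K) (hodd : Odd (NumberField.discr K))
    (h3 : NumberField.discr K ≠ -3) (hH : SatisfiesHeegnerHypothesis (W.conductorNorm ℤ) K)
    (hsurj : W.HasSurjectiveModNGaloisRep ((2 : ℤ) ^ 1))
    {Dt : ModularParametrizationData W (W.conductorNorm ℤ)} {β : ℤ} {ι : K →+* ℂ} (d₁ : KolyvaginHeegnerData Dt β ι 1)
    {M₀ : ℕ} (hM : 1 ≤ M₀)
    (hdiv : ∃ Q : (W.baseChange (ringClassField K ι 1)).toAffine.Point, ((2 ^ M₀ : ℕ) : ℤ) • Q = d₁.derivedPoint) :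
    d₁.kolyvaginClass Nat.prime_two 1 = 0 := by
  let fam : (m : ℕ) → m ∣ 1 → KolyvaginHeegnerData Dt β ι m := fun m hm ↦ (Nat.dvd_one.mp hm).symm ▸ d₁
  have hfam : fam 1 dvd_rfl = d₁ := by simp [fam]
  have h := GenusKoly.kolyvaginClass_two_ne_zero_iff_not_two_dvd hK hodd h3 hH hsurj squarefree_one
    (fun q hq ↦ absurd hq (by simp)) fam
  rw [hfam] at h
  by_contra hne
  obtain ⟨Q, hQ⟩ := hdiv
  refine (h.mp hne) ⟨((2 ^ (M₀ - 1) : ℕ) : ℤ) • Q, ?_⟩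
  rw [← mul_zsmul, ← hQ]
  congr 1
  rw [show M₀ = (M₀ - 1) + 1 from (Nat.sub_add_cancel hM).symm]
  push_cast
  ring

/-- **Q2 ⟹ `hlam` at every Kolyvagin prime, with McCallum-compatible data.**  On the habitat (`W` non-CM, `ρ̄_{E,2^m}` onto for all `m` — Q2's own binder; from the crux's `∀ n > 0` form by
`MinimalTwinBSDTwo.forall_hasSurjectiveModNGaloisRep_two_pow_of_pos`), `K` imaginary
quadratic with odd `d_K ≠ −3` and the Heegner hypothesis, a conductor-`1` datum `d₁` on the `M₀ ≥ 1` cell (`2^{M₀} ∣ P(1)`, `M₀ ≥ 1`): GIVEN the route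
item Q2 `KolyvaginRelationAtTwo` (stmt-24880, McCallum Prop. 4.4 at `p = 2`), for every Kolyvagin prime `ℓ` at `2` there is a datum `d` of conductor
`1·ℓ` COMPATIBLE with `d₁` (JET's `exists_compatible_data_of_grossCM`) whose class `c₁(ℓ)` satisfies the Selmer condition at every place of `K` above
`ℓ`: Q2 at `(m, l, M, j) = (1, ℓ, 1, 0)` transports `loc_λ c₁(1) = 0` (previous lemma).  CONDITIONAL on Q2 only. [cite: McCallumLMS1991, §4 Prop. 4.4, Cor. 4.5]
[cite: GrossLMS1991, §3 Prop. 3.7, §6 Prop. 6.2 (2)] -/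
theorem exists_compatible_kolyvaginClass_two_mem_selmerLocalKer_of_relation (hQ2 : KolyvaginRelationAtTwo) (hcm : ¬ W.HasCM)
    (hρ : ∀ m : ℕ, W.HasSurjectiveModNGaloisRep (2 ^ m : ℕ))
    (hK : IsImaginaryQuadratic K) (hodd : Odd (NumberField.discr K)) (h3 : NumberField.discr K ≠ -3)
    (hH : SatisfiesHeegnerHypothesis (W.conductorNorm ℤ) K)
    (Dt : ModularParametrizationData W (W.conductorNorm ℤ)) (β : ℤ) (ι : K →+* ℂ) (d₁ : KolyvaginHeegnerData Dt β ι 1)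
    {M₀ : ℕ} (hM : 1 ≤ M₀)
    (hdiv : ∃ Q : (W.baseChange (ringClassField K ι 1)).toAffine.Point, ((2 ^ M₀ : ℕ) : ℤ) • Q = d₁.derivedPoint)
    {ℓ : ℕ} (hKoly : Zhang2014.IsKolyvaginPrime (W.conductorNorm ℤ) W K 2 ℓ) :
    ∃ d : KolyvaginHeegnerData Dt β ι (1 * ℓ),
      (∀ s ∈ d₁.S, ∃ s' ∈ d.S, ∀ (x : ringClassField K ι 1) (x' : ringClassField K ι (1 * ℓ)),
          (x : ℂ) = x' → ((s' x' : ringClassField K ι (1 * ℓ)) : ℂ) = (s x : ℂ)) ∧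
      (∀ s' ∈ d.S, ∃ s ∈ d₁.S, ∀ (x : ringClassField K ι 1) (x' : ringClassField K ι (1 * ℓ)),
          (x : ℂ) = x' → ((s' x' : ringClassField K ι (1 * ℓ)) : ℂ) = (s x : ℂ)) ∧
      (∀ (x : ringClassField K ι 1) (x' : ringClassField K ι (1 * ℓ)), (x : ℂ) = x' → d.emb x' = d₁.emb x) ∧
      ∀ v : HeightOneSpectrum (𝓞 K), ((ℓ : ℕ) : 𝓞 K) ∈ v.asIdeal →
        d.kolyvaginClass Nat.prime_two 1 ∈ selmerLocalKer (W.baseChange K) (v.adicCompletion K) ((2 ^ 1 : ℕ) : ℤ) := by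
  have hℓ : ℓ.Prime := hKoly.1
  have h4 : NumberField.discr K ≠ -4 := fun h ↦ by
    rw [h] at hodd
    exact (Int.not_even_iff_odd.mpr hodd) ⟨-2, by norm_num⟩
  have hD : NumberField.discr K < -4 := GenusKoly.discr_lt_neg_four_of_odd hK hodd h3
  have hsurj : W.HasSurjectiveModNGaloisRep ((2 : ℤ) ^ 1) := by exact_mod_cast hρ 1
  -- compatible data at `1·ℓ'` for every Kolyvagin prime `ℓ'`
  obtain ⟨dℓ, hdℓ⟩ := JET.exists_compatible_data_of_grossCM
    (phi_heegnerPointOfConductor_mem_range_map_ringClassField_holds (W.conductorNorm ℤ) W K) hK hD hH 2 Dt β ι squarefree_one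
    (fun q hq ↦ absurd hq (by simp)) d₁
  have hℓ1 : ℓ ∉ (1 : ℕ).primeFactors := by simp
  obtain ⟨-, hS, hS', hemb⟩ := hdℓ ℓ hKoly hℓ1
  refine ⟨dℓ ℓ hKoly hℓ1, hS, hS', hemb, fun v hv ↦ ?_⟩
  -- Q2 at `(m, l, M, j) = (1, ℓ, 1, 0)`
  have hsq : Squarefree (1 * ℓ) := by rw [one_mul]; exact hℓ.squarefree
  have hall : ∀ l' ∈ (1 * ℓ).primeFactors, Zhang2014.IsKolyvaginPrime (W.conductorNorm ℤ) W K 2 l' ∧ 1 ≤ Zhang2014.kolyvaginIndex W 2 l' := by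
    intro l' hl'
    rw [one_mul, hℓ.primeFactors, Finset.mem_singleton] at hl'
    subst hl'
    exact ⟨hKoly, hKoly.2.2.2.2.2⟩
  have hv' : (((ℓ : ℕ) : 𝓞 K)) ∈ v.asIdeal := hv
  have hQ := hQ2 W hcm K hK h3 h4 hH hρ Dt β ι 1 le_rfl 1 ℓ hsq hℓ (by simp [hℓ.ne_one]) hall d₁ (dℓ ℓ hKoly hℓ1)
    (fun l' hl' ↦ absurd hl' (by simp)) hS hS' hemb v hv' 0
  have h0 : ((2 ^ 0 : ℕ) : ℤ) • d₁.kolyvaginClass Nat.prime_two 1 ∈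
      (W.baseChange K).torsionLocalKer (v.adicCompletion K) ((2 ^ 1 : ℕ) : ℤ) := by
    rw [kolyvaginClass_two_one_eq_zero_of_depth_pos hK hodd h3 hH hsurj d₁ hM hdiv, zsmul_zero]
    exact AddSubgroup.zero_mem _
  have h := hQ.1.mpr (hQ.2.mpr h0)
  simpa using h

end Relation

end Summit.BirchSwinnertonDyer.BirchSwinnertonDyer.Theorems.GenusSupplyNarrow.KFourCell

end
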